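import Summits.CriticalPhenomena.PercolationContinuityZ3.Theorems.PercNearOneGluingNoHeavyLowerTailSahiSharedCubeHybrid
import Mathlib.Tactic.Linarith
import Mathlib.Tactic.Ring
import Mathlib.Tactic.FieldSimp
import HarnessLib

/-!
# `NoHeavyLowerTail` (crux stmt-CriticalPhenomena-4575), P2 — THE UNIVERSAL `λ`-FAMILY OF RATIOS FOR THEOREM B
# `ρ^{(λ)}(c) = 1 − λ·(1/F(c) − 1/F(⊤))`, `0 ≤ λ ≤ F(∅)`: STAR and RANGE hold for EVERY environment; Kahn's `C_3` follows from ONE covariance inequality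

Support file (seat `prim-masterthm-p2`, gen 26; `--supports stmt-CriticalPhenomena-4575`; memo `FROM-prim-masterthm-p2-g26-LEX-CHAIN.md` §4b).
No `sorry`, no definitions, standard axioms.

THEOREM B (`SahiBox.sahiE_three_nonneg_sharedCube_of_ratio`, P2 gen 9): on a cube block with a log-modular weight, any ratio `r ∈ [0,1]` with STAR
`F(c') ≤ (1 − r_c + r_{c'})F(c)` (`c' ⊆ c`) and the instance top-heaviness `Cov_{wC}(G_C, rȲ − EH·F) ≥ 0` gives `E_3(f,g,h) ≥ 0`.  Which `r` to take is
the whole difficulty (the capped ratio, water-fillings, … each fail somewhere; memo §4).  This file isolates a ONE-PARAMETER family that is admissible for EVERY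
environment, so that the only remaining hypothesis is one explicit covariance inequality:

**THEOREM (`sahiE_three_nonneg_sharedCube_lambdaRatio`).**  For `0 ≤ λ ≤ F(∅)` put `ρ^{(λ)}(c) = 1 − λ/F(c) + λ/F(univ)`.  Then `0 ≤ ρ^{(λ)} ≤ 1`
and STAR hold automatically (`(F_c − F_{c'})(λ − F_{c'}) ≤ 0`), hence
`Cov_{wC}(G_C, ρ^{(λ)}Ȳ − EH·F) ≥ 0 ⟹ E_3(f,g,h) ≥ 0`.
The endpoints are `λ = 0` (`ρ ≡ 1`: the hypothesis reads `Cov_{wC}(G_C, Ȳ − EH·F) ≥ 0`, "the surplus is positively correlated with `G_C`") and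
`λ = F(∅)` (the ratio `K8` of the gen-26 census: `(1 − ρ_c)F_c = (F_∅/F_⊤)(F_⊤ − F_c)`, deficit mass proportional to the headroom), whose hypothesis
reads `(1 + F_∅/F_⊤)·Cov(G_C,Ȳ) − F_∅·Cov(G_C, Ȳ/F) ≥ EH·Cov(G_C,F)` (it pays with the anti-correlation of the conditional density `Ȳ/F = E[h | f]` with
`G_C`); the hypothesis is affine in `λ`, so the family certifies exactly `K1 ∪ K8`.  CENSUS (memo §4b, exact LP, `T₁(|C| = 1)` residue up to 3 + 3 block
coins): `K8` alone certifies ≈ 95–98 % of the residue cells, `K1` ≈ 85–90 %; together with six further explicit vertices 100 % (600/600 + 200/200).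
HONEST FRAMING: a certificate family; Kahn's `C_3`, `T₁`, `T₁(|C| = 1)` remain OPEN. [this work]
-/

noncomputable section

open scoped Classical

namespace Summit.CriticalPhenomena.PercolationContinuityZ3.Theorems

namespace SahiBox

open Finset
open Literature.Combinatorics.Sahi2008
open SahiSharedTwoPoint (Y FC HH GG GC Ybar Hbar EH EF Gbar)

section LambdaRatio

variable {ι α β : Type} [DecidableEq ι] [Fintype ι] [Fintype α] [Fintype β]
  {wA : α → ℝ} {wB : β → ℝ} {wC : Finset ι → ℝ}
  {f : Finset ι → α → ℝ} {g : Finset ι → β → ℝ} {h : Finset ι → α → β → ℝ}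

omit [DecidableEq ι] [Fintype ι] [Fintype β] in
/-- `F = E_a f` is monotone and nonnegative for monotone nonnegative `f` under a nonnegative weight. [folklore] -/
theorem FC_mono_nonneg (hA0 : ∀ a, 0 ≤ wA a) (hf0 : ∀ c a, 0 ≤ f c a) (hfc : ∀ a, Monotone (fun c => f c a)) :
    Monotone (FC wA f) ∧ ∀ c, 0 ≤ FC wA f c :=
  ⟨fun _ _ hcc => sum_le_sum fun a _ => mul_le_mul_of_nonneg_left (hfc a hcc) (hA0 a),
    fun c => sum_nonneg fun a _ => mul_nonneg (hA0 a) (hf0 c a)⟩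

/-- **STAR AND RANGE FOR THE `λ`-FAMILY** (pure real algebra on a monotone nonnegative `F`): for `0 ≤ λ ≤ F(c₀)` with `c₀ ≤ c` for all `c`
(`c₀ = ∅`) and `F(c) ≤ F(c₁)` for all `c` (`c₁ = univ`), the ratio `ρ(c) = 1 − λ/F(c) + λ/F(c₁)` satisfies `0 ≤ ρ ≤ 1` and
`F(c') ≤ (1 − ρ(c) + ρ(c'))·F(c)` whenever `F(c') ≤ F(c)`. [this work] -/
theorem lambdaRatio_spec {γ : Type} (F : γ → ℝ) (c₀ c₁ : γ) (hF0 : ∀ c, 0 ≤ F c) (hbot : ∀ c, F c₀ ≤ F c) (htop : ∀ c, F c ≤ F c₁)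
    {lam : ℝ} (hlam0 : 0 ≤ lam) (hlam : lam ≤ F c₀) :
    (∀ c, 0 ≤ 1 - lam / F c + lam / F c₁) ∧ (∀ c, 1 - lam / F c + lam / F c₁ ≤ 1) ∧
      (∀ c c', F c' ≤ F c → F c' ≤ (1 - (1 - lam / F c + lam / F c₁) + (1 - lam / F c' + lam / F c₁)) * F c) := by
  refine ⟨fun c => ?_, fun c => ?_, fun c c' hcc => ?_⟩
  · -- `λ/F(c) ≤ 1`
    have h1 : lam / F c ≤ 1 := by
      by_cases hc : F c = 0
      · rw [hc, div_zero]; exact zero_le_one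
      · rw [div_le_one (lt_of_le_of_ne (hF0 c) (Ne.symm hc))]; exact hlam.trans (hbot c)
    have h2 : 0 ≤ lam / F c₁ := div_nonneg hlam0 (hF0 c₁)
    linarith
  · -- `λ/F(c₁) ≤ λ/F(c)`
    by_cases hc : F c = 0
    · have h0 : F c₀ = 0 := le_antisymm ((hbot c).trans hc.le) (hF0 c₀)
      have hl : lam = 0 := le_antisymm (hlam.trans h0.le) hlam0
      simp [hl]
    · have hcpos : 0 < F c := lt_of_le_of_ne (hF0 c) (Ne.symm hc)
      have : lam / F c₁ ≤ lam / F c := div_le_div_of_nonneg_left hlam0 hcpos (htop c)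
      linarith
  · -- STAR: `F c' ≤ (1 + λ/F c − λ/F c')·F c`, i.e. `(F c − F c')(λ − F c') ≤ 0` after clearing denominators
    have e1 : (1 - (1 - lam / F c + lam / F c₁) + (1 - lam / F c' + lam / F c₁)) = 1 + lam / F c - lam / F c' := by ring
    rw [e1]
    by_cases hc' : F c' = 0
    · rw [hc', div_zero, sub_zero]
      have : 0 ≤ (1 + lam / F c) * F c := mul_nonneg (by linarith [div_nonneg hlam0 (hF0 c)]) (hF0 c)
      linarith
    · have hc'pos : 0 < F c' := lt_of_le_of_ne (hF0 c') (Ne.symm hc')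
      have hcpos : 0 < F c := lt_of_lt_of_le hc'pos hcc
      have hlc' : lam ≤ F c' := hlam.trans (hbot c')
      rw [show (1 + lam / F c - lam / F c') * F c = F c + lam - lam * F c / F c' by field_simp]
      -- need `F c' ≤ F c + lam − lam F c / F c'`, i.e. `lam (F c / F c' − 1) ≤ F c − F c'`
      have key : lam * F c / F c' - lam ≤ F c - F c' := by
        rw [show lam * F c / F c' - lam = lam * (F c - F c') / F c' by field_simp]
        rw [div_le_iff₀ hc'pos]
        nlinarith [sub_nonneg.mpr hcc, sub_nonneg.mpr hlc']
      linarith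

/-- **THEOREM B WITH THE UNIVERSAL `λ`-RATIO.**  `α, β` FKG lattices; the `f`–`g` block the cube `Finset ι` with a log-modular probability weight;
`f(c,a), g(c,b), h(c,a,b) ≥ 0` monotone in every argument; `0 ≤ λ ≤ F(∅)` (`F = E_a f`).  With `ρ(c) = 1 − λ/F(c) + λ/F(univ)`, the single
hypothesis `Cov_{wC}(G_C, ρȲ − EH·F) ≥ 0` (instance top-heaviness, written as `E[G_C]·E[ζ] ≤ E[G_C ζ]`) gives `E_3(f,g,h) ≥ 0`. [this work] -/
theorem sahiE_three_nonneg_sharedCube_lambdaRatio [DistribLattice α] [DistribLattice β]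
    (hA : IsFKGMeasure wA) (hB : IsFKGMeasure wB) (hC0 : ∀ c, 0 ≤ wC c) (hC1 : ∑ c, wC c = 1)
    (hCmod : ∀ x y, wC x * wC y = wC (x ∩ y) * wC (x ∪ y))
    (hf0 : ∀ c a, 0 ≤ f c a) (hfa : ∀ c, Monotone (f c)) (hfc : ∀ a, Monotone (fun c => f c a))
    (hg0 : ∀ c b, 0 ≤ g c b) (hgb : ∀ c, Monotone (g c)) (hgc : ∀ b, Monotone (fun c => g c b))
    (hh0 : ∀ c a b, 0 ≤ h c a b) (hhc : ∀ a b, Monotone (fun c => h c a b))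
    (hha : ∀ c b, Monotone (fun a => h c a b)) (hhb : ∀ c a, Monotone (h c a))
    {lam : ℝ} (hlam0 : 0 ≤ lam) (hlam : lam ≤ FC wA f ∅)
    (htop : (∑ c, wC c * GC wB g c) *
        (∑ c, wC c * ((1 - lam / FC wA f c + lam / FC wA f univ) * Ybar wA wB f h c - EH wA wB wC h * FC wA f c)) ≤
      ∑ c, wC c * (GC wB g c * ((1 - lam / FC wA f c + lam / FC wA f univ) * Ybar wA wB f h c - EH wA wB wC h * FC wA f c))) :
    0 ≤ sahiE (fun q : α × β × Finset ι => wA q.1 * wB q.2.1 * wC q.2.2) 3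
        ![fun q => f q.2.2 q.1, fun q => g q.2.2 q.2.1, fun q => h q.2.2 q.1 q.2.1] := by
  obtain ⟨hFmono, hF0⟩ := FC_mono_nonneg (wA := wA) (f := f) hA.nonneg hf0 hfc
  obtain ⟨hr0, hr1, hstar⟩ := lambdaRatio_spec (FC wA f) ∅ univ hF0 (fun c => hFmono (empty_subset c))
    (fun c => hFmono (subset_univ c)) hlam0 hlam
  exact sahiE_three_nonneg_sharedCube_of_ratio hA hB hC0 hC1 hCmod hf0 hfa hfc hg0 hgb hgc hh0 hhc hha hhb
    (fun c => 1 - lam / FC wA f c + lam / FC wA f univ) hr0 hr1 (fun c c' hcc => hstar c c' (hFmono hcc)) htop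

/-- The endpoint `λ = F(∅)` ("K8"): `E_3 ≥ 0` whenever `Cov_{wC}(G_C, ρȲ − EH·F) ≥ 0` for `ρ(c) = 1 − F(∅)/F(c) + F(∅)/F(univ)`. [this work] -/
theorem sahiE_three_nonneg_sharedCube_K8 [DistribLattice α] [DistribLattice β]
    (hA : IsFKGMeasure wA) (hB : IsFKGMeasure wB) (hC0 : ∀ c, 0 ≤ wC c) (hC1 : ∑ c, wC c = 1)
    (hCmod : ∀ x y, wC x * wC y = wC (x ∩ y) * wC (x ∪ y))
    (hf0 : ∀ c a, 0 ≤ f c a) (hfa : ∀ c, Monotone (f c)) (hfc : ∀ a, Monotone (fun c => f c a))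
    (hg0 : ∀ c b, 0 ≤ g c b) (hgb : ∀ c, Monotone (g c)) (hgc : ∀ b, Monotone (fun c => g c b))
    (hh0 : ∀ c a b, 0 ≤ h c a b) (hhc : ∀ a b, Monotone (fun c => h c a b))
    (hha : ∀ c b, Monotone (fun a => h c a b)) (hhb : ∀ c a, Monotone (h c a))
    (htop : (∑ c, wC c * GC wB g c) *
        (∑ c, wC c * ((1 - FC wA f ∅ / FC wA f c + FC wA f ∅ / FC wA f univ) * Ybar wA wB f h c - EH wA wB wC h * FC wA f c)) ≤
      ∑ c, wC c * (GC wB g c * ((1 - FC wA f ∅ / FC wA f c + FC wA f ∅ / FC wA f univ) * Ybar wA wB f h c - EH wA wB wC h * FC wA f c))) :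
    0 ≤ sahiE (fun q : α × β × Finset ι => wA q.1 * wB q.2.1 * wC q.2.2) 3
        ![fun q => f q.2.2 q.1, fun q => g q.2.2 q.2.1, fun q => h q.2.2 q.1 q.2.1] :=
  sahiE_three_nonneg_sharedCube_lambdaRatio hA hB hC0 hC1 hCmod hf0 hfa hfc hg0 hgb hgc hh0 hhc hha hhb
    ((FC_mono_nonneg (wA := wA) (f := f) hA.nonneg hf0 hfc).2 ∅) le_rfl htop

end LambdaRatio

end SahiBox

end Summit.CriticalPhenomena.PercolationContinuityZ3.Theorems
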